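import Summits.ABC.ABC.Theses.CubicResolventAllowance
import Summits.ABC.ABC.Theorems.CubicResolventAllowanceResolventDiscBoundsCaps
import Literature.Barriers.ABC.SzpiroEpsilonCannotBeDroppedProofs
import HarnessLib

/-!
# stub-ideation k2 (RESHAPE) — generation 7 sketch for `stub_complexCubic` (crux `IndexSzpiro`, stmt-ABC-22740)

Companion to `STUB-IDEAS-stub_complexCubic-2.md` (gen 7). The stub (`Stub` below, verbatim) is the crux
`IndexSzpiro` restricted to the complex resolvent class `d_K < 0`; gens 1–6 (k1/k2/k3) showed every `K`-free
re-cut is Szpiro-hard.  New in gen 7 — two PROVABLE packages, each ≤ 1–2 prover cycles, with in-tree templates: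

* §N  **NODE LEMMA** (`NL_*`): `p ≥ 5`, an integral model with `¬ (p ∣ c₄ ∧ p ∣ Δ)` ⇒ `v_p(d_K) ≤ 1` for the
  cubic resolvent field — purely via Dedekind (tree caps machinery) + "total ramification forces cube-shaped
  minimal polynomials mod p" + "`ψ₂ ≡ 4(X−c)³ (mod p)` forces a cusp (`p ∣ c₄, p ∣ Δ`)".  It discharges k2-gen-5
  `AllowanceExact` (AE2, the last non-Szpiro input of the sandwich) WITHOUT Tate curves / Néron–Ogg–Shafarevich.
* §F  **ε = 0 IS FALSE IN THE COMPLEX CLASS** (`not_stubEpsZero`): an explicit infinite family (complex twin of the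
  tree's Bennett–Yazdani orbit, `Literature.Barriers.ABC.BennettYazdani.*`): `E₀ : Y² = X³ + 18³`,
  `Q₀ = (−63/4, 351/8)`, `X_{j+1} = x(2Q_j)`, `λ_j = 1 − 54/(X_j + 18) = a/n`, `W_j : y² + 3a·xy + (a³−n³)·y = x³`.
  Then `Δ(W_j) = 27 n³ (a³−n³)³ < 0`, `n(a³−n³) = −18 w²`, `W_j` is a global minimal model, multiplicative at 2 and at
  every `p ≥ 5`, `f₃ ≤ 5`, `ψ₂` irreducible (3-adic), and the resolvent field is INERT: `|d_K| ∣ 2³·3⁵` (parity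
  `v_p(d_K) ≡ v_p(Δ_min) = 6 v_p(w) (mod 2)` + node lemma + caps).  Hence `2^{6j+3} N⁶ ≤ 3²¹ |Δ_min|` and no
  constant `C` works at `ε = 0`.  PARI check (job j344850, j ≤ 3): `d_K = −216` constant, ratio ×64 per step.

`lean check`: rc 0, 13 sorries, ONLY in helper bodies marked (S)/(M) (NL2a NL2b NL AE2 F1 F2 F3b F3c F3d F4a F4 F5 F6);
VERIFIED: NL1, F3_Δ, F3_c₄, F3_isElliptic, F3a, F7 `deepEvenComplexFamily` (from F1–F6), `exists_resolventField`,
`not_stubEpsZero` (from F7), `stub_of_indexSzpiro`.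
-/

open Polynomial
open IsDedekindDomain WeierstrassCurve Rat.HeightOneSpectrum
open scoped NumberField

namespace Summit.ABC.ABC.Cruxes.IndexSzpiro.StubIdeas2G7

open Summit.ABC.ABC.Theses.CubicResolventAllowance (IndexSzpiro)
open Literature.Barriers.ABC.BennettYazdani (c₄_mk Δ_mk isElliptic_mk)

/-! ## §0  The stub (verbatim) and its ε = 0 companion -/

/-- `stub_complexCubic`, verbatim. -/
def Stub : Prop :=
  ∀ ε : ℝ, 0 < ε → ∃ C : ℝ, ∀ (W : WeierstrassCurve ℚ) [W.IsElliptic] (K : Type) [Field K] [NumberField K],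
    Irreducible W.twoTorsionPolynomial.toPoly → Module.finrank ℚ K = 3 →
    (∃ θ : K, aeval θ W.twoTorsionPolynomial.toPoly = 0) → NumberField.discr K < 0 →
    (W.minimalDiscriminantNorm ℤ : ℝ) ≤ C * |(NumberField.discr K : ℝ)| * (W.conductorNorm ℤ : ℝ) ^ (6 + ε)

/-- (VERIFIED, trivial) the crux gives the stub by forgetting the sign. -/
theorem stub_of_indexSzpiro (h : IndexSzpiro) : Stub := by
  intro ε hε
  obtain ⟨C, hC⟩ := h ε hε
  exact ⟨C, fun W _ K _ _ hirr h3 hθ _ => hC W K hirr h3 hθ⟩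

/-- The stub AT `ε = 0` (still with the `|d_K|` allowance).  §F proves it is FALSE: the exponent-`ε` is
load-bearing even inside the complex resolvent class, and the refuting family is the natural first test of any
proposed proof of the stub (it must use `ε > 0` at the prime 2: `v₂(Δ_min) = 6j + 9` with `f₂ = 1`). -/
def StubEpsZero : Prop :=
  ∃ C : ℝ, ∀ (W : WeierstrassCurve ℚ) [W.IsElliptic] (K : Type) [Field K] [NumberField K],
    Irreducible W.twoTorsionPolynomial.toPoly → Module.finrank ℚ K = 3 →
    (∃ θ : K, aeval θ W.twoTorsionPolynomial.toPoly = 0) → NumberField.discr K < 0 →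
    (W.minimalDiscriminantNorm ℤ : ℝ) ≤ C * |(NumberField.discr K : ℝ)| * (W.conductorNorm ℤ : ℝ) ^ (6 : ℕ)

/-! ## §N  The node lemma (closes k2-gen-5 `AllowanceExact` / AE2 elementarily) -/

/-- **NL1 (VERIFIED).** Over `𝔽_p`, `p ≥ 5`: if the 2-division cubic is `4(X − c)³` then `c₄ = 0` and `Δ = 0`
(compare coefficients: `b₂ = −12c, b₄ = 6c², b₆ = −4c³`; then `c₄ = b₂² − 24 b₄ = 0` and `4Δ = 0` via
Mathlib `WeierstrassCurve.b_relation`). -/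
theorem NL1_cusp_of_cube {p : ℕ} [Fact p.Prime] (hp5 : 5 ≤ p) (W : WeierstrassCurve (ZMod p)) (c : ZMod p)
    (h : W.twoTorsionPolynomial.toPoly = C (4 : ZMod p) * (X - C c) ^ 3) :
    W.c₄ = 0 ∧ W.Δ = 0 := by
  have hp := (Fact.out : p.Prime)
  have hne : ∀ m : ℕ, 0 < m → m < 5 → (m : ZMod p) ≠ 0 := by
    intro m hm0 hm5 hm
    rw [ZMod.natCast_eq_zero_iff] at hm
    have := Nat.le_of_dvd hm0 hm
    omega
  have h2 : (2 : ZMod p) ≠ 0 := by exact_mod_cast hne 2 (by norm_num) (by norm_num)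
  have h4 : (4 : ZMod p) ≠ 0 := by exact_mod_cast hne 4 (by norm_num) (by norm_num)
  have hcub : W.twoTorsionPolynomial = ⟨4, -(12 * c), 12 * c ^ 2, -(4 * c ^ 3)⟩ := by
    rw [← Cubic.toPoly_injective, h]
    simp only [Cubic.toPoly, map_neg, map_mul, map_pow, map_ofNat]
    ring
  simp only [WeierstrassCurve.twoTorsionPolynomial, Cubic.mk.injEq] at hcub
  obtain ⟨-, hb2, hb4, hb6⟩ := hcub
  have hb4' : W.b₄ = 6 * c ^ 2 := mul_left_cancel₀ h2 (by rw [hb4]; ring)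
  refine ⟨?_, ?_⟩
  · simp only [WeierstrassCurve.c₄]
    rw [hb2, hb4']; ring
  · apply mul_left_cancel₀ h4
    have e : 4 * W.Δ = -W.b₂ ^ 2 * (4 * W.b₈) - 32 * W.b₄ ^ 3 - 108 * W.b₆ ^ 2
        + 36 * W.b₂ * W.b₄ * W.b₆ := by
      simp only [WeierstrassCurve.Δ]; ring
    rw [e, W.b_relation, hb2, hb4', hb6]; ring

variable (K : Type) [Field K] [NumberField K]

/-- **NL2a (S/M).** `[K:ℚ] = 3 < 5 ≤ p` and `v_p(d_K) ≥ 2` ⇒ some prime `P | p` of `𝓞 K` has `e(P|p) = 3`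
(tame: `ord_P 𝔇 = e − 1`, tree `multiplicity_differentIdeal_int_eq_of_not_dvd`; `v_p(d_K) ≤ Σ f·ord_P 𝔇`,
tree `padicValNat_discr_le_sum`; `Σ e f = 3`, tree `sum_ramificationIdx_mul_inertiaDeg`; if all `e ≤ 2` the
sum is `≤ 1`). [cite: NeukirchANT1999, Ch. III (2.6)] -/
theorem NL2a_exists_ramificationIdx_eq_three (h3 : Module.finrank ℚ K = 3) {p : ℕ} (hp : p.Prime)
    (hp5 : 5 ≤ p) (h2 : 2 ≤ padicValNat p (NumberField.discr K).natAbs) :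
    ∃ P ∈ IsDedekindDomain.primesOverFinset (Ideal.span {(p : ℤ)}) (𝓞 K), P.ramificationIdx ℤ = 3 := by
  sorry

/-- **NL2b (M).** Total ramification forces cube-shaped minimal polynomials: if `e(P|p) = 3 = [K:ℚ]`
(so `P³ = p𝓞_K`, `f = 1`), every `η ∈ 𝓞_K` of degree 3 has `minpoly_ℤ(η) ≡ (X − c)³ (mod p)`.
Proof route (no completions): `η ≡ c (mod P)` with `c ∈ ℤ` (`f = 1`); `α = η − c ∈ P`; with `m = v_P(α)`:
`m ≥ 3 ⇒ α ∈ p𝓞_K ⇒ all coefficients divisible by p`; `m ∈ {1,2}`: `v_p(N α) = m` (`|N α| = ∏ N(Q)^{v_Q}`,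
Mathlib `Ideal.absNorm_span_singleton` + unique prime over p) and the ultrametric inequality in
`α³ + e₁α² + e₂α + e₃ = 0` force `p ∣ e₁, p ∣ e₂`.  (Alternative: trace route via tree
`dvd_differentIdeal_iff_trace`, `P² ∣ 𝔇`.) [cite: NeukirchANT1999, Ch. I (8.2), Ch. III (2.6)] -/
theorem NL2b_minpoly_eq_cube_mod (h3 : Module.finrank ℚ K = 3) {p : ℕ} (hp : p.Prime)
    {P : Ideal (𝓞 K)} (hP : P ∈ IsDedekindDomain.primesOverFinset (Ideal.span {(p : ℤ)}) (𝓞 K))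
    (he : P.ramificationIdx ℤ = 3) (η : 𝓞 K) (hdeg : (minpoly ℤ η).natDegree = 3) :
    ∃ c : ℤ, (minpoly ℤ η).map (Int.castRingHom (ZMod p)) = (X - C (c : ZMod p)) ^ 3 := by
  sorry

/-- **NL (S, assembly of NL1 + NL2a + NL2b + k1-g5 `K2a_monic_root`/`K3_monic_irreducible`).**  THE NODE LEMMA:
for an integral model `W₀`, a prime `p ≥ 5` with `¬ (p ∣ c₄ ∧ p ∣ Δ)` (reduction mod p smooth or a NODE) is at most
simply ramified in the cubic resolvent field: `v_p(d_K) ≤ 1`.  (`η = 4θ` has `minpoly = X³ + b₂X² + 8b₄X + 16b₆`;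
if `v_p(d_K) ≥ 2` then NL2 makes it `(X − c)³ mod p`, i.e. `ψ₂ ≡ 4(X − c/4)³`, and NL1 gives `p ∣ c₄ ∧ p ∣ Δ`.) -/
theorem NL_padicValNat_discr_le_one (W₀ : WeierstrassCurve ℤ)
    (hirr : Irreducible (W₀.baseChange ℚ).twoTorsionPolynomial.toPoly) (h3 : Module.finrank ℚ K = 3)
    (hθ : ∃ θ : K, aeval θ (W₀.baseChange ℚ).twoTorsionPolynomial.toPoly = 0)
    {p : ℕ} (hp : p.Prime) (hp5 : 5 ≤ p) (hnode : ¬ ((p : ℤ) ∣ W₀.c₄ ∧ (p : ℤ) ∣ W₀.Δ)) :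
    padicValNat p (NumberField.discr K).natAbs ≤ 1 := by
  sorry

/-- **AE2 (S from NL).** k2-gen-5 `AllowanceExact`, clause (ii): `f_p ≤ 1` at `p ≥ 5` ⇒ `v_p(d_K) ≤ 1`.
(Take a `p`-minimal integral model — tree `hasGlobalMinimalModel_rat_holds`, k1-g5 `K1_root_transport`;
`f_p ≤ 1` ⇒ not additive ⇒ `¬ (p ∣ c₄ ∧ p ∣ Δ)` for the minimal model — tree `SzpiroLocalDataProofs`
reduction-type lemmas; then NL.) -/
theorem AE2_of_conductorExponent_le_one (W : WeierstrassCurve ℚ) [W.IsElliptic]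
    (hirr : Irreducible W.twoTorsionPolynomial.toPoly) (h3 : Module.finrank ℚ K = 3)
    (hθ : ∃ θ : K, aeval θ W.twoTorsionPolynomial.toPoly = 0)
    {p : ℕ} (hp : p.Prime) (hp5 : 5 ≤ p) (v : HeightOneSpectrum ℤ) (hv : natGenerator v = p)
    (hf : W.conductorExponent v ≤ 1) :
    padicValNat p (NumberField.discr K).natAbs ≤ 1 := by
  sorry

/-! ## §F  The refuting family for `ε = 0` in the complex class -/

/-- `x`-coordinate duplication on `E₀ : Y² = X³ + 5832` (`5832 = 18³`; cf. the tree's `X³ − 216`). -/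
def dbl (X : ℚ) : ℚ := (X ^ 4 - 46656 * X) / (4 * (X ^ 3 + 5832))

/-- The orbit `X_j = x(2^j Q₀)`, `Q₀ = (−63/4, 351/8) = 2·(18, 108)`. -/
def Xorb (j : ℕ) : ℚ := dbl^[j] (-63 / 4)

/-- **F1 (M, template `BennettYazdani.orbit` / `padicValRat_dbl` / `exists_start`).**  Along the orbit the points stay
on `E₀`, `ord₂ X_j = −2 − 2j` (2-adic formal group), and the 3-ADIC COSET INVARIANT `X_j = 9u`, `u ≡ 2 (mod 3)`
(i.e. `ord₃ X_j = 2`, `ord₃ (X_j − 18) ≥ 3`) is preserved by `dbl` (`X' = 9u(u³−64)/(4(u³+8))`,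
`u⁴ − 8u³ − 64u − 64 ≡ 0 (mod 3)` at `u ≡ 2`).  Start: `ord₂(−63/4) = −2`, `−63/4 = 9·(−7/4)`, `−63/4 − 18 = −135/4`. -/
theorem F1_orbit (j : ℕ) :
    (∃ Y : ℚ, Y ^ 2 = Xorb j ^ 3 + 5832) ∧ padicValRat 2 (Xorb j) = -2 - 2 * j ∧
      padicValRat 3 (Xorb j) = 2 ∧ 3 ≤ padicValRat 3 (Xorb j - 18) := by
  sorry

/-- **F2 (M, template `BennettYazdani.exists_params`).**  THE PARAMETERS: for such `X` write
`λ = 1 − 54/(X + 18) = a/n` in lowest terms (`λ = −x(T + Q)/18`, `T = (−18, 0)`).  Then `a, n` are odd and coprime,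
`3 ∤ a n`, `v₃(a³ − n³) = 2`, `v₂(a³ − n³) = 3 + 2j`, and `n(a³ − n³) = −18 w²` with `w = 3n²Y/(X+18)² ∈ ℤ ∖ 0`,
`2^{j+1} ∣ w` (`λ³ − 1 = −162 Y²/(X + 18)⁴`, the translation-by-`T` formula `x' + 18 = 972/(x + 18)`). -/
theorem F2_params {X : ℚ} {j : ℕ} (hsq : ∃ Y : ℚ, Y ^ 2 = X ^ 3 + 5832)
    (h2 : padicValRat 2 X = -2 - 2 * j) (h3 : padicValRat 3 X = 2) (h3' : 3 ≤ padicValRat 3 (X - 18)) :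
    ∃ a n w : ℤ, IsCoprime a n ∧ Odd a ∧ Odd n ∧ ¬ (3 : ℤ) ∣ a ∧ ¬ (3 : ℤ) ∣ n ∧
      padicValInt 3 (a ^ 3 - n ^ 3) = 2 ∧ n * (a ^ 3 - n ^ 3) = -18 * w ^ 2 ∧ w ≠ 0 ∧
      (2 : ℤ) ^ (j + 1) ∣ w := by
  sorry

section Model

/-- The Hesse-type model `W(a,n) : y² + 3a·xy + (a³ − n³)·y = x³` (integral; `E[3] ⊇ μ₃`-type family as in the
tree's BY file, with `(a, b) = (3a, a³ − n³)`, so `a³ − 27b` there becomes `27 n³` here). -/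
abbrev hesseModel (a n : ℤ) : WeierstrassCurve ℤ := WeierstrassCurve.mk (3 * a) 0 (a ^ 3 - n ^ 3) 0 0

variable {a n w : ℤ} {j : ℕ}

/-- (VERIFIED) `Δ(W(a,n)) = 27 n³ (a³ − n³)³`. -/
theorem F3_Δ (a n : ℤ) : (hesseModel a n).Δ = 27 * n ^ 3 * (a ^ 3 - n ^ 3) ^ 3 := by
  rw [hesseModel, Δ_mk]; ring

/-- (VERIFIED) `c₄(W(a,n)) = 9a(a³ + 8n³)`. -/
theorem F3_c₄ (a n : ℤ) : (hesseModel a n).c₄ = 9 * a * (a ^ 3 + 8 * n ^ 3) := by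
  rw [hesseModel, c₄_mk]; ring

/-- (VERIFIED) `W(a,n) ⊗ ℚ` is an elliptic curve when `n ≠ 0`, `a³ ≠ n³`. -/
theorem F3_isElliptic (hn : n ≠ 0) (hb : a ^ 3 - n ^ 3 ≠ 0) : ((hesseModel a n).baseChange ℚ).IsElliptic :=
  isElliptic_mk hb (by
    have : (3 * a) ^ 3 - 27 * (a ^ 3 - n ^ 3) = 27 * n ^ 3 := by ring
    rw [this]; exact mul_ne_zero (by norm_num) (pow_ne_zero 3 hn))

/-- **F3a (VERIFIED).** The 2-division cubic of `W(a,n)`: `ψ₂ = 4X³ + 9a²X² + 6a(a³−n³)X + (a³−n³)²`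
(`b₂ = 9a², b₄ = 3a(a³−n³), b₆ = (a³−n³)²`). -/
theorem F3_twoTorsion (a n : ℤ) :
    ((hesseModel a n).baseChange ℚ).twoTorsionPolynomial.toPoly =
      C (4 : ℚ) * X ^ 3 + C ((9 * a ^ 2 : ℤ) : ℚ) * X ^ 2 + C ((6 * a * (a ^ 3 - n ^ 3) : ℤ) : ℚ) * X +
        C (((a ^ 3 - n ^ 3) ^ 2 : ℤ) : ℚ) := by
  have hcub : ((hesseModel a n).baseChange ℚ).twoTorsionPolynomial =
      ⟨4, ((9 * a ^ 2 : ℤ) : ℚ), ((6 * a * (a ^ 3 - n ^ 3) : ℤ) : ℚ), (((a ^ 3 - n ^ 3) ^ 2 : ℤ) : ℚ)⟩ := by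
    simp only [WeierstrassCurve.twoTorsionPolynomial, WeierstrassCurve.baseChange, hesseModel,
      WeierstrassCurve.b₂, WeierstrassCurve.b₄, WeierstrassCurve.b₆, WeierstrassCurve.map_a₁, WeierstrassCurve.map_a₂, WeierstrassCurve.map_a₃,
      WeierstrassCurve.map_a₄, WeierstrassCurve.map_a₆, Cubic.mk.injEq, eq_intCast]
    push_cast
    refine ⟨trivial, by ring, by ring, by ring⟩
  rw [hcub, Cubic.toPoly]

/-- **F3b (S/M, template `BennettYazdani.isMinimalAt_mk`).**  `W(a,n)` is a GLOBAL MINIMAL MODEL: at `p = 2` and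
`p ≥ 5` dividing `Δ` one has `p ∤ c₄ = 9a(a³+8n³)` (`a` odd, `a ⊥ n`), elsewhere `p¹² ∤ Δ`; at `p = 3`,
`v₃(Δ) = 3 + 3·2 + 0 = 9 < 12` (tree `isMinimalAt_baseChange_int_of_not_dvd_c₄` / `_of_not_pow_dvd_Δ`). -/
theorem F3_isMinimalAt (hc : IsCoprime a n) (ha : Odd a) (h3n : ¬ (3 : ℤ) ∣ n)
    (h3b : padicValInt 3 (a ^ 3 - n ^ 3) = 2) (v : HeightOneSpectrum ℤ) :
    ((hesseModel a n).baseChange ℚ).IsMinimalAt v := by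
  sorry

/-- **F3c (S, template `BennettYazdani.conductorExponent_mk_eq`).**  Away from 3 the model is semistable:
`f_p = 1` at the primes `p ≠ 3` of `Δ`, `f_p = 0` at the others (tree `conductorExponent_eq_one_of_dvd_Δ_of_not_dvd_c₄`,
`conductorExponent_eq_zero_of_not_dvd_Δ`); at 3, `f₃ ≤ 5` is the tree's
`conductorExponent_le_five_of_natGenerator_eq_three_holds`. -/
theorem F3_conductorExponent_of_ne_three [((hesseModel a n).baseChange ℚ).IsElliptic]
    (hc : IsCoprime a n) (ha : Odd a) (v : HeightOneSpectrum ℤ) (hv : natGenerator v ≠ 3) :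
    ((hesseModel a n).baseChange ℚ).conductorExponent v =
      if (natGenerator v : ℤ) ∣ (hesseModel a n).Δ then 1 else 0 := by
  sorry

/-- **F3d (S).** `|Δ_min| = |Δ(W(a,n))| = 27 |n|³ |a³−n³|³` (tree `minimalDiscriminantNorm_eq_natAbs_holds` + F3b). -/
theorem F3_minimalDiscriminantNorm [((hesseModel a n).baseChange ℚ).IsElliptic]
    (hc : IsCoprime a n) (ha : Odd a) (h3n : ¬ (3 : ℤ) ∣ n) (h3b : padicValInt 3 (a ^ 3 - n ^ 3) = 2) :
    ((hesseModel a n).baseChange ℚ).minimalDiscriminantNorm ℤ = (27 * n ^ 3 * (a ^ 3 - n ^ 3) ^ 3).natAbs := by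
  sorry

/-- **F4a (M-small, template `BennettYazdani.conductorNorm_sq_mul_dvd`).**  `N · 2^{j+1} ∣ 2 · 3⁵ · |w|`:
`N` is squarefree away from 3 and supported on the primes of `Δ = 27 n³(a³−n³)³ ∣ (18 w²)³·(…)`, `v₃(N) ≤ 5`,
`v₂(N) = 1`, `2^{j+1} ∣ w` (tree `conductorNorm_dvd_of_forall_conductorExponent_le`, `factorization_conductorNorm_holds`). -/
theorem F4_conductorNorm_mul_dvd [((hesseModel a n).baseChange ℚ).IsElliptic]
    (hc : IsCoprime a n) (ha : Odd a) (hw : n * (a ^ 3 - n ^ 3) = -18 * w ^ 2) (hw0 : w ≠ 0)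
    (h2w : (2 : ℤ) ^ (j + 1) ∣ w) :
    ((hesseModel a n).baseChange ℚ).conductorNorm ℤ * 2 ^ (j + 1) ∣ 2 * 3 ^ 5 * w.natAbs := by
  sorry

/-- **F4 (S from F4a + F3d).**  `2^{6j+3} · N⁶ ≤ 3²¹ · |Δ_min|`
(`|Δ_min| = 27·|n(a³−n³)|³ = 27·18³·w⁶ = 2³3⁹w⁶` and `(N·2^{j+1})⁶ ≤ 2⁶3³⁰w⁶`). -/
theorem F4_ineq [((hesseModel a n).baseChange ℚ).IsElliptic]
    (hc : IsCoprime a n) (ha : Odd a) (h3n : ¬ (3 : ℤ) ∣ n) (h3b : padicValInt 3 (a ^ 3 - n ^ 3) = 2)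
    (hw : n * (a ^ 3 - n ^ 3) = -18 * w ^ 2) (hw0 : w ≠ 0) (h2w : (2 : ℤ) ^ (j + 1) ∣ w) :
    2 ^ (6 * j + 3) * ((hesseModel a n).baseChange ℚ).conductorNorm ℤ ^ 6 ≤
      3 ^ 21 * ((hesseModel a n).baseChange ℚ).minimalDiscriminantNorm ℤ := by
  sorry

/-- **F5 (M-small).** IRREDUCIBILITY of `ψ₂ = 4X³ + 9a²X² + 6ab'X + b'²` (`b' = a³ − n³`) from the 3-adic invariant
`3 ∤ a`, `v₃(b') = 2`: a rational root `r` would have `v₃(r) ∈ ℤ`, and each case `v₃ r ≤ 0`, `= 1`, `≥ 2` leaves a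
unique term of minimal 3-adic valuation (`9a²r²` resp. `b'²`); degree 3 + no root ⇒ irreducible
(Mathlib `Polynomial.irreducible_of_degree_le_three_of_not_isRoot` / `Cubic` API). -/
theorem F5_irreducible (h3a : ¬ (3 : ℤ) ∣ a) (h3b : padicValInt 3 (a ^ 3 - n ^ 3) = 2) :
    Irreducible ((hesseModel a n).baseChange ℚ).twoTorsionPolynomial.toPoly := by
  sorry

/-- **F6 (S from NL + k1-g5 `K6_Δ_eq_sq_mul_discr`/`discr_neg_iff_Δ_neg` + tree caps).**  RESOLVENT INERTNESS:
every cubic field generated by a root of `ψ₂(W(a,n))` is complex with `|d_K| ∣ 2³·3⁵ = 1944`: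
`d_K < 0 ⟺ Δ = 27 (n(a³−n³))³ = 27(−18w²)³ < 0`; for `p ≥ 5`, `v_p(d_K) ≡ v_p(Δ) = 6 v_p(w) (mod 2)` (K6) and
`v_p(d_K) ≤ 1` (NL: `p ∣ Δ ⇒ p ∤ c₄`), so `v_p(d_K) = 0`; `v₂ ≤ 3`, `v₃ ≤ 5` (tree `padicValNat_two_discr_le_three`,
`padicValNat_three_discr_le_five`).  [PARI j344850: in fact `d_K = −216` for j ≤ 3.] -/
theorem F6_resolvent_inert (hc : IsCoprime a n) (ha : Odd a) (h3n : ¬ (3 : ℤ) ∣ n)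
    (h3b : padicValInt 3 (a ^ 3 - n ^ 3) = 2) (hw : n * (a ^ 3 - n ^ 3) = -18 * w ^ 2) (hw0 : w ≠ 0)
    (h3 : Module.finrank ℚ K = 3)
    (hθ : ∃ θ : K, aeval θ ((hesseModel a n).baseChange ℚ).twoTorsionPolynomial.toPoly = 0) :
    NumberField.discr K < 0 ∧ (NumberField.discr K).natAbs ∣ 1944 := by
  sorry

end Model

/-- **F7 (S, assembly of F1–F6).**  THE FAMILY: for every `j` an elliptic curve over `ℚ` in the complex resolvent
class, with inert resolvent field, and `2^{6j+3} N⁶ ≤ 3²¹ |Δ_min|`. -/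
theorem deepEvenComplexFamily (j : ℕ) :
    ∃ (W : WeierstrassCurve ℚ) (_ : W.IsElliptic), Irreducible W.twoTorsionPolynomial.toPoly ∧
      (∀ (K : Type) [Field K] [NumberField K], Module.finrank ℚ K = 3 →
        (∃ θ : K, aeval θ W.twoTorsionPolynomial.toPoly = 0) →
          NumberField.discr K < 0 ∧ (NumberField.discr K).natAbs ∣ 1944) ∧
      2 ^ (6 * j + 3) * W.conductorNorm ℤ ^ 6 ≤ 3 ^ 21 * W.minimalDiscriminantNorm ℤ := by
  obtain ⟨hsq, h2, h3, h3'⟩ := F1_orbit j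
  obtain ⟨a, n, w, hc, ha, hn, h3a, h3n, h3b, hw, hw0, h2w⟩ := F2_params hsq h2 h3 h3'
  have hn0 : n ≠ 0 := by rintro rfl; simp at hn
  have hb : a ^ 3 - n ^ 3 ≠ 0 := by
    intro hb; apply hw0
    have : -18 * w ^ 2 = 0 := by rw [← hw, hb, mul_zero]
    have : w ^ 2 = 0 := by linarith
    exact pow_eq_zero_iff (n := 2) (by norm_num) |>.mp this
  haveI hE := F3_isElliptic hn0 hb
  exact ⟨(hesseModel a n).baseChange ℚ, hE, F5_irreducible h3a h3b,
    fun K _ _ hK hθ => F6_resolvent_inert K hc ha h3n h3b hw hw0 hK hθ,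
    F4_ineq hc ha h3n h3b hw hw0 h2w⟩

/-- (VERIFIED, = k2-gen-5 `exists_resolventField`) a stem field of the irreducible 2-division cubic. -/
theorem exists_resolventField (W : WeierstrassCurve ℚ) (hirr : Irreducible W.twoTorsionPolynomial.toPoly) :
    ∃ (K : Type) (_ : Field K) (_ : NumberField K),
      Module.finrank ℚ K = 3 ∧ ∃ θ : K, aeval θ W.twoTorsionPolynomial.toPoly = 0 := by
  haveI : Fact (Irreducible W.twoTorsionPolynomial.toPoly) := ⟨hirr⟩
  have hdeg : W.twoTorsionPolynomial.toPoly.natDegree = 3 :=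
    Cubic.natDegree_of_a_ne_zero (by norm_num [WeierstrassCurve.twoTorsionPolynomial])
  have hfin : Module.finrank ℚ (AdjoinRoot W.twoTorsionPolynomial.toPoly) = 3 := by
    rw [(AdjoinRoot.powerBasis hirr.ne_zero).finrank, AdjoinRoot.powerBasis_dim, hdeg]
  have hroot := AdjoinRoot.aeval_eq (f := W.twoTorsionPolynomial.toPoly) W.twoTorsionPolynomial.toPoly
  rw [AdjoinRoot.mk_self] at hroot
  have keyfin : ∀ inst : Module ℚ (AdjoinRoot W.twoTorsionPolynomial.toPoly),
      @Module.finrank ℚ (AdjoinRoot W.twoTorsionPolynomial.toPoly) _ _ inst = 3 := by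
    intro inst
    obtain rfl := Subsingleton.elim inst
      (@Algebra.toModule _ _ _ _ (AdjoinRoot.instAlgebra W.twoTorsionPolynomial.toPoly))
    exact hfin
  have keyroot : ∀ inst : Algebra ℚ (AdjoinRoot W.twoTorsionPolynomial.toPoly),
      @aeval ℚ (AdjoinRoot W.twoTorsionPolynomial.toPoly) _ _ inst
        (AdjoinRoot.root W.twoTorsionPolynomial.toPoly) W.twoTorsionPolynomial.toPoly = 0 := by
    intro inst
    obtain rfl := Subsingleton.elim inst (AdjoinRoot.instAlgebra W.twoTorsionPolynomial.toPoly)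
    exact hroot
  exact ⟨AdjoinRoot W.twoTorsionPolynomial.toPoly, inferInstance, inferInstance, keyfin _,
    AdjoinRoot.root _, keyroot _⟩

/-- **N7 (VERIFIED from F7).**  `ε = 0` FAILS in the complex resolvent class, allowance included. -/
theorem not_stubEpsZero : ¬ StubEpsZero := by
  rintro ⟨C, hC⟩
  obtain ⟨j, hj⟩ := pow_unbounded_of_one_lt (3 ^ 21 * (max C 0 * 1944)) (by norm_num : (1 : ℝ) < 2)
  obtain ⟨W, hE, hirr, hK, hineq⟩ := deepEvenComplexFamily j
  haveI := hE
  obtain ⟨K, _, _, h3, hθ⟩ := exists_resolventField W hirr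
  obtain ⟨hneg, hdvd⟩ := hK K h3 hθ
  have h1 := hC W K hirr h3 hθ hneg
  have hdK : |(NumberField.discr K : ℝ)| ≤ 1944 := by
    have h := Nat.le_of_dvd (by norm_num) hdvd
    rw [← Int.cast_abs, Int.abs_eq_natAbs]
    exact_mod_cast h
  have hN1 : (1 : ℝ) ≤ (W.conductorNorm ℤ : ℝ) := by
    have h := conductorNorm_pos_holds W
    exact_mod_cast h
  have hN6 : (0 : ℝ) < (W.conductorNorm ℤ : ℝ) ^ 6 := by positivity
  have hineqR : (2 : ℝ) ^ (6 * j + 3) * (W.conductorNorm ℤ : ℝ) ^ 6 ≤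
      3 ^ 21 * (W.minimalDiscriminantNorm ℤ : ℝ) := by exact_mod_cast hineq
  have hC0 : 0 ≤ max C 0 := le_max_right _ _
  have habs : 0 ≤ |(NumberField.discr K : ℝ)| := abs_nonneg _
  have h2 : (W.minimalDiscriminantNorm ℤ : ℝ) ≤ max C 0 * 1944 * (W.conductorNorm ℤ : ℝ) ^ 6 :=
    calc (W.minimalDiscriminantNorm ℤ : ℝ)
        ≤ C * |(NumberField.discr K : ℝ)| * (W.conductorNorm ℤ : ℝ) ^ 6 := h1
      _ ≤ max C 0 * |(NumberField.discr K : ℝ)| * (W.conductorNorm ℤ : ℝ) ^ 6 := by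
          gcongr; exact le_max_left _ _
      _ ≤ max C 0 * 1944 * (W.conductorNorm ℤ : ℝ) ^ 6 := by gcongr
  have h4 : (2 : ℝ) ^ (6 * j + 3) * (W.conductorNorm ℤ : ℝ) ^ 6 ≤
      (3 ^ 21 * (max C 0 * 1944)) * (W.conductorNorm ℤ : ℝ) ^ 6 :=
    calc (2 : ℝ) ^ (6 * j + 3) * (W.conductorNorm ℤ : ℝ) ^ 6
        ≤ 3 ^ 21 * (W.minimalDiscriminantNorm ℤ : ℝ) := hineqR
      _ ≤ 3 ^ 21 * (max C 0 * 1944 * (W.conductorNorm ℤ : ℝ) ^ 6) := by gcongr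
      _ = (3 ^ 21 * (max C 0 * 1944)) * (W.conductorNorm ℤ : ℝ) ^ 6 := by ring
  have h5 : (2 : ℝ) ^ (6 * j + 3) ≤ 3 ^ 21 * (max C 0 * 1944) := le_of_mul_le_mul_right h4 hN6
  have h6 : (2 : ℝ) ^ j ≤ 2 ^ (6 * j + 3) := pow_le_pow_right₀ (by norm_num) (by omega)
  linarith

/-- (VERIFIED) … so any proof of the stub must spend its `ε` (on the family: at the prime 2 alone). -/
theorem stub_needs_eps : ¬ StubEpsZero ∧ (IndexSzpiro → Stub) := ⟨not_stubEpsZero, stub_of_indexSzpiro⟩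

end Summit.ABC.ABC.Cruxes.IndexSzpiro.StubIdeas2G7
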